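import Summits.Ventures.CertifiedManyBodySolver.Theorems.TcThermcert1FreeCanonicalFugacityPullThroughCreation
import HarnessLib

/-!
# Free canonical gas at `β·t = 8` — the complex-fugacity Fermi kernel exists off the negative real axis and is symmetric

Helper file for route `TcThermcert1` (crux K1′ `ThermalStiffnessCeilingU8b8_le_7o44`, item `stmt-Ventures-24560`), crux idea
`free-canonical-b8-rung`. The pull-through identities (`fugacity_pullThrough`, `fugacity_pullThrough_creation`,
`fugacity_pullThrough_current_twoLeg`) are stated for ANY left inverses `G'` of `1 + ζE_σ` and `G''` of `1 + ζE_σᵀ` and a kernel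
`G_ζ = ζG'E_σ` symmetric on the bond. This file discharges those hypotheses where the scheme needs them:

* §1 the spin block `E_σ` of `e^{−βh}` (`h` Hermitian) is POSITIVE DEFINITE (principal submatrix of the tree's `posDef_gibbsWeight`);
* §2 for a positive definite `E` and every complex `ζ` OFF THE NEGATIVE REAL AXIS (`0 ≤ Re ζ` or `Im ζ ≠ 0`) the matrix `1 + ζE` is
  invertible (if `(1 + ζE)v = 0`, `v ≠ 0`, then `ζ = −‖v‖²/⟨v,Ev⟩ < 0`) — so the poles of the scheme sit at `ζ = −1/κ`, `κ ∈ spec E_σ`,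
  i.e. only on the ray `φ = π` of the fugacity circle, and the GOOD ARC `|φ| ≤ φ₀ < π` is pole-free for every radius;
* §3 for a SYMMETRIC `E` (real hopping: time reversal) the inverse `G' = (1 + ζE)⁻¹` is a two-sided inverse of both `1 + ζE` and
  `1 + ζEᵀ`, commutes with `E`, and the kernel `ζG'E` is a symmetric matrix — the hypotheses `hG'`, `hG''`, `hsymm` of the two-leg identity.

HONEST LABEL: finite-dimensional linear algebra; a step of a RUNG (`U = 0`, BC5-type witness for the C8 bet), reach at `U = 8` ZERO; decides
nothing about K1/K1′/`T_c`; superconductivity in the Hubbard model is NOT proved or advanced by this file beyond the rung.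
-/

noncomputable section

namespace Summit.Ventures.CertifiedManyBodySolver.Theorems.TcThermcert1.FreeCanonicalB8

open NormedSpace Matrix Finset
open Literature.MathematicalPhysics.QuantumLattice
open scoped ComplexOrder

variable {Λ : Type*} [LinearOrder Λ] [Fintype Λ]

/-! ## §1 The spin block of the one-body Gibbs factor is positive definite -/

/-- For Hermitian `h` on the orbitals, the spin-`σ` block `E_σ(x,y) = (e^{−βh})_{xσ,yσ}` is positive definite. -/
theorem spinBlock_exp_posDef (β : ℝ) {h : Matrix (Orb Λ) (Orb Λ) ℂ} (hh : h.IsHermitian) (σ : Fin 2)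
    (Eσ : Matrix Λ Λ ℂ) (hEσ : ∀ x y : Λ, Eσ x y = (exp (-((β : ℂ) • h))) (orb x σ) (orb y σ)) : Eσ.PosDef := by
  have hE : (exp (-((β : ℂ) • h))).PosDef := by
    have h1 := posDef_gibbsWeight β hh
    rwa [gibbsWeight, neg_smul] at h1
  have hsub : Eσ = (exp (-((β : ℂ) • h))).submatrix (fun x : Λ => orb x σ) (fun x : Λ => orb x σ) := by
    ext x y
    rw [submatrix_apply, hEσ]
  rw [hsub]
  exact hE.submatrix fun x y hxy => (orb_inj.1 hxy).1

/-! ## §2 `1 + ζE` is invertible off the negative real axis -/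

/-- For a positive definite `E` and `ζ` with `0 ≤ Re ζ` or `Im ζ ≠ 0` (i.e. `ζ ∉ (−∞, 0)`), `1 + ζE` is invertible. -/
theorem isUnit_one_add_smul_of_posDef {E : Matrix Λ Λ ℂ} (hE : E.PosDef) {ζ : ℂ} (hζ : 0 ≤ ζ.re ∨ ζ.im ≠ 0) :
    IsUnit (1 + ζ • E) := by
  classical
  rw [← Matrix.mulVec_injective_iff_isUnit]
  intro v w hvw
  by_contra hne
  have hu0 : v - w ≠ 0 := sub_ne_zero.2 hne
  have hker : (1 + ζ • E) *ᵥ (v - w) = 0 := by rw [Matrix.mulVec_sub, hvw, sub_self]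
  have hpos := (Matrix.posDef_iff_dotProduct_mulVec.1 hE).2 hu0
  have hone := (Matrix.posDef_iff_dotProduct_mulVec.1 (Matrix.PosDef.one (n := Λ) (R := ℂ))).2 hu0
  rw [Matrix.one_mulVec] at hone
  have h0 : star (v - w) ⬝ᵥ ((1 + ζ • E) *ᵥ (v - w)) = 0 := by rw [hker, dotProduct_zero]
  rw [Matrix.add_mulVec, Matrix.one_mulVec, Matrix.smul_mulVec, dotProduct_add, dotProduct_smul, smul_eq_mul] at h0
  obtain ⟨n_re, n_im⟩ := Complex.pos_iff.1 hone
  obtain ⟨p_re, p_im⟩ := Complex.pos_iff.1 hpos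
  have hre := congrArg Complex.re h0
  have him := congrArg Complex.im h0
  simp only [Complex.add_re, Complex.mul_re, Complex.add_im, Complex.mul_im, Complex.zero_re, Complex.zero_im] at hre him
  rw [← n_im, ← p_im] at him
  rw [← p_im] at hre
  have hζim : ζ.im = 0 := by
    have : ζ.im * (star (v - w) ⬝ᵥ E *ᵥ (v - w)).re = 0 := by linarith
    exact (mul_eq_zero.1 this).resolve_right p_re.ne'
  rcases hζ with h | h
  · nlinarith [mul_nonneg h p_re.le]
  · exact h hζim

/-! ## §3 Symmetric `E`: the inverse serves both legs and the kernel `ζG'E` is symmetric -/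

/-- For `E` symmetric and `1 + ζE` invertible, `G' = (1 + ζE)⁻¹` is a left inverse of `1 + ζE` AND of `1 + ζEᵀ`, it commutes with
`E`, and the complex-fugacity Fermi kernel `ζ G' E` is a symmetric matrix (hypotheses `hG'`, `hG''`, `hsymm` of
`fugacity_pullThrough_current_twoLeg`). -/
theorem fugacityKernel_of_symmetric (E : Matrix Λ Λ ℂ) (hEt : Eᵀ = E) {ζ : ℂ} (hU : IsUnit (1 + ζ • E)) :
    (1 + ζ • E)⁻¹ * (1 + ζ • E) = 1 ∧ (1 + ζ • E)⁻¹ * (1 + ζ • Eᵀ) = 1 ∧ (1 + ζ • E)⁻¹ * E = E * (1 + ζ • E)⁻¹ ∧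
      ∀ a b : Λ, (ζ • ((1 + ζ • E)⁻¹ * E)) a b = (ζ • ((1 + ζ • E)⁻¹ * E)) b a := by
  have hdet : IsUnit (1 + ζ • E).det := (Matrix.isUnit_iff_isUnit_det _).1 hU
  have h1 : (1 + ζ • E)⁻¹ * (1 + ζ • E) = 1 := Matrix.nonsing_inv_mul _ hdet
  have h2 : (1 + ζ • E) * (1 + ζ • E)⁻¹ = 1 := Matrix.mul_nonsing_inv _ hdet
  have hcommE : E * (1 + ζ • E) = (1 + ζ • E) * E := by
    rw [Matrix.mul_add, Matrix.add_mul, Matrix.mul_one, Matrix.one_mul, Matrix.mul_smul, Matrix.smul_mul]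
  have hcomm : (1 + ζ • E)⁻¹ * E = E * (1 + ζ • E)⁻¹ := by
    calc (1 + ζ • E)⁻¹ * E = (1 + ζ • E)⁻¹ * E * ((1 + ζ • E) * (1 + ζ • E)⁻¹) := by rw [h2, Matrix.mul_one]
      _ = (1 + ζ • E)⁻¹ * (E * (1 + ζ • E)) * (1 + ζ • E)⁻¹ := by simp only [Matrix.mul_assoc]
      _ = (1 + ζ • E)⁻¹ * ((1 + ζ • E) * E) * (1 + ζ • E)⁻¹ := by rw [hcommE]
      _ = ((1 + ζ • E)⁻¹ * (1 + ζ • E)) * E * (1 + ζ • E)⁻¹ := by simp only [Matrix.mul_assoc]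
      _ = E * (1 + ζ • E)⁻¹ := by rw [h1, Matrix.one_mul]
  have hT : (1 + ζ • E)ᵀ = 1 + ζ • E := by rw [transpose_add, transpose_one, transpose_smul, hEt]
  have hGt : ((1 + ζ • E)⁻¹)ᵀ = (1 + ζ • E)⁻¹ := by rw [transpose_nonsing_inv, hT]
  have hKt : ((1 + ζ • E)⁻¹ * E)ᵀ = (1 + ζ • E)⁻¹ * E := by rw [transpose_mul, hEt, hGt, ← hcomm]
  refine ⟨h1, by rw [hEt, h1], hcomm, fun a b => ?_⟩
  rw [Matrix.smul_apply, Matrix.smul_apply]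
  congr 1
  rw [← hKt, transpose_apply, hKt]

/-- **The good arc is pole-free, package for the free spin-diagonal gas.** For `h` Hermitian with symmetric spin-`σ` block `E_σ` of
`e^{−βh}` and every `ζ` off the negative real axis: `1 + ζE_σ` is invertible and `G' = (1 + ζE_σ)⁻¹` satisfies the three kernel
hypotheses of the two-leg pull-through identity. -/
theorem fugacityKernel_exists (β : ℝ) {h : Matrix (Orb Λ) (Orb Λ) ℂ} (hh : h.IsHermitian) (σ : Fin 2)
    (Eσ : Matrix Λ Λ ℂ) (hEσ : ∀ x y : Λ, Eσ x y = (exp (-((β : ℂ) • h))) (orb x σ) (orb y σ)) (hEt : Eσᵀ = Eσ)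
    {ζ : ℂ} (hζ : 0 ≤ ζ.re ∨ ζ.im ≠ 0) :
    ∃ G' : Matrix Λ Λ ℂ, G' * (1 + ζ • Eσ) = 1 ∧ G' * (1 + ζ • Eσᵀ) = 1 ∧ G' * Eσ = Eσ * G' ∧
      ∀ a b : Λ, (ζ • (G' * Eσ)) a b = (ζ • (G' * Eσ)) b a :=
  ⟨(1 + ζ • Eσ)⁻¹, fugacityKernel_of_symmetric Eσ hEt (isUnit_one_add_smul_of_posDef (spinBlock_exp_posDef β hh σ Eσ hEσ) hζ)⟩

end Summit.Ventures.CertifiedManyBodySolver.Theorems.TcThermcert1.FreeCanonicalB8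

end
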